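import Literature.Computability.AlgebraicComplexity.PerDetHwvCertificateGlue
import Literature.Computability.AlgebraicComplexity.PerDetHwvCertificatePoint
import Literature.Computability.AlgebraicComplexity.TableauHighestWeight
import HarnessLib

/-!
# Discharging the certificate semantics: a verified certificate bounds the multiplicity unconditionally

Lean checker of the GCT multiplicity-obstruction engine (cell `pub-gct`; honest framing: rung-1
multiplicity-obstruction search for permanent versus determinant at small `(n, m)`, no claim about
VP ≠ VNP or P ≠ NP), step H1e (assembly). `PerDetHwvCertificateGlue.lean` derived the perm-side
lower bound and `m < dc(per_n)` from a kernel-verified certificate CONDITIONALLY on the hypothesis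
structure `Cert.Semantics` (H1). Here H1 is DISCHARGED for every certificate whose networks use
the engine's canonical alternators (`Cert.canonical`: column of height `h` antisymmetrises the
variables `0, …, h-1`, hwv `FORMAT.md` §2 — a decidable check):

* `Cert.semantics`: the functions `F_i` are the tableau polynomials `TabM.tabPoly` of the
  networks (alternator variable `r` ↦ the `r`-th largest matrix entry, `matIdxEnum`), which lie in
  `highestWeightSpace (coordRep (MatIdx m) K m) λ^*` (`TabM.tabPoly_mem_highestWeightSpace`,
  weight bookkeeping `dualOfPartition_toMatIdx_x`, `card_filter_height_eq`); the points are
  `γ_j · X₀₀^{m-n} per_n` with `γ_j = liftMat g_j * renameMat ρ`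
  (`splfPoly_paddedPermPoint_eq_linSubst`); and the kernel's integer `Cert.evalInt i j` is their
  value (`TabM.EC_ofNetwork`, `aeval_formCoeff_tabPoly`, naturality `evalC_map`).
* **`Cert.le_orbitMultiplicity`**: `c.verify = true → c.canonical = true →
  c.r ≤ mult_{λ^*} K[Δ(X₀₀^{m-n} per_n)]` — no hypothesis structure left;
* **`Cert.lt_determinantalComplexity`**: plus the det-side number
  `symKroneckerCoeffRect K m d λ ≤ c.sk` (H2) gives `m < dc(per_n)`.

What the kernel must still be told as a number is ONLY `sk` (two-engine record; decidable on
small closed instances by the tree's `DetOrbitSymKroneckerBoundEval`). Elementary assembly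
[folklore] of the cited constructions (Dörfler–Ikenmeyer–Panova 2020 §5; BLMW 2011 Prop. 5.2.1;
Ikenmeyer–Panova 2017 Thm. 1.3 as proved in the tree).
-/

noncomputable section

open scoped BigOperators

namespace Literature.Computability.AlgebraicComplexity

namespace TableauEval

open MvPolynomial
open _root_.Literature.NumberTheory.DiophantineGeometry

/-! ## §1 Unpacking the checks -/

/-- What `Network.check` guarantees. [folklore] -/
theorem Network.spec_of_check (N : Network) (h : N.check = true) :
    (∀ c ∈ N.cols, c.vars.length = c.labels.length) ∧
      (∀ c ∈ N.cols, ∀ u ∈ c.labels, u < N.nlabels) ∧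
      (∀ u, u < N.nlabels → countNat u N.allLabels = N.perLabel) := by
  simp only [Network.check, Bool.and_eq_true, List.all_eq_true, beq_iff_eq, decide_eq_true_eq,
    and_assoc, List.mem_range] at h
  obtain ⟨h1, -, h3, h4⟩ := h
  refine ⟨fun c hc => (h1 c hc).1, fun c hc u hu => h3 u ?_, h4⟩
  exact List.mem_flatMap.mpr ⟨c, hc, hu⟩

namespace Cert

/-- The engine's canonical alternators: the column of height `h` antisymmetrises the variables
`0, …, h-1` (hwv `FORMAT.md` §2). Decidable; holds for every exported certificate. [folklore] -/
def canonical (c : Cert) : Bool :=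
  c.hwvs.all fun N => N.cols.all fun col => col.vars == List.range col.labels.length

/-- What `structural` guarantees about the shape list and the networks. [folklore] -/
theorem spec2_of_structural (c : Cert) (h : c.structural = true) :
    c.lam.IsChain (· ≥ ·) ∧
      ∀ N ∈ c.hwvs, N.check = true ∧ N.nlabels = c.d ∧ N.perLabel = c.m ∧ N.shape = c.lam := by
  have h' := h
  simp only [structural, Bool.and_eq_true, decide_eq_true_eq, List.all_eq_true, beq_iff_eq,
    and_assoc] at h'
  obtain ⟨-, -, -, -, -, h6, h7, -⟩ := h'
  refine ⟨isChain_ge_of_zipWith c.lam (List.all_eq_true.mpr h6), fun N hN => ?_⟩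
  obtain ⟨a, b, c', d, -⟩ := h7 N hN
  exact ⟨a, b, c', d⟩

/-! ## §2 The terms of a certificate point have `m` forms -/

/-- Every term of `paddedPermPoint n m g` (`n ≤ m`) has exactly `m` linear forms. [folklore] -/
theorem length_forms_paddedPermPoint {R : Type*} [CommRing R] {n m : ℕ} (hnm : n ≤ m)
    (g : List (List R)) (t : Fin (paddedPermPoint n m g).terms.length) :
    ((paddedPermPoint n m g).terms.get t).2.length = m := by
  unfold paddedPermPoint at t ⊢
  rw [List.get_eq_getElem, List.getElem_map]
  simp only [List.length_append, List.length_map, List.length_range, List.length_replicate]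
  omega

/-! ## §3 The semantics of a verified canonical certificate -/

/-- The `i`-th network with the certificate's own `(d, m)` (equal to the network's by the
structural check; using `c.m` makes the tableau polynomial live in degree `c.m` definitionally).
[folklore] -/
def net (c : Cert) (i : ℕ) : Network := ⟨c.d, c.m, (c.hwvs.getD i ⟨0, 0, []⟩).cols⟩

/-- For an in-range index of a structurally sound certificate, `c.net i` IS the `i`-th network.
[folklore] -/
theorem net_eq (c : Cert) (h : c.structural = true) {i : ℕ} (hi : i < c.hwvs.length) :
    c.net i = c.hwvs.getD i ⟨0, 0, []⟩ := by
  have hmem : c.hwvs.getD i ⟨0, 0, []⟩ ∈ c.hwvs := by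
    rw [List.getD_eq_getElem _ _ hi]; exact List.getElem_mem _
  obtain ⟨-, hd, hm, -⟩ := (c.spec2_of_structural h).2 _ hmem
  unfold net
  cases hN : c.hwvs.getD i ⟨0, 0, []⟩ with
  | mk d m cols =>
    rw [hN] at hd hm
    simp only at hd hm ⊢
    rw [← hd, ← hm]

/-- The structural data of `c.net i`. [folklore] -/
theorem net_spec (c : Cert) (h : c.structural = true) {i : ℕ} (hi : i < c.hwvs.length) :
    (∀ cl ∈ (c.net i).cols, cl.vars.length = cl.labels.length) ∧
      (∀ cl ∈ (c.net i).cols, ∀ u ∈ cl.labels, u < (c.net i).nlabels) ∧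
      (∀ u, u < (c.net i).nlabels → countNat u (c.net i).allLabels = (c.net i).perLabel) ∧
      (c.net i).shape = c.lam := by
  have hmem : c.hwvs.getD i ⟨0, 0, []⟩ ∈ c.hwvs := by
    rw [List.getD_eq_getElem _ _ hi]; exact List.getElem_mem _
  obtain ⟨hck, hd, hm, hsh⟩ := (c.spec2_of_structural h).2 _ hmem
  obtain ⟨a, b, cc⟩ := Network.spec_of_check _ hck
  rw [c.net_eq h hi]
  exact ⟨a, b, cc, hsh⟩

variable {K : Type} [Field K] [CharZero K]

/-- Heights of the columns of a network of shape `λ` are at most `|λ|`. [folklore] -/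
theorem height_le_length (N : Network) (lam : List ℕ) (hshape : N.shape = lam)
    (col : Fin N.cols.length) : (N.cols.get col).labels.length ≤ lam.length := by
  have h1 : (N.cols.get col).labels.length ≤ (N.cols.map fun c => c.labels.length).foldr max 0 :=
    ArithCircuit.le_foldr_max_of_mem (List.mem_map.mpr ⟨_, List.get_mem _ _, rfl⟩)
  have h2 : (N.cols.map fun c => c.labels.length).foldr max 0 = N.shape.length := by
    rw [Network.shape, List.length_map, List.length_range]
  rw [h2, hshape] at h1
  exact h1

/-- Entries of a canonical alternator list. [folklore] -/
theorem get_vars_of_canonical (cl : Column) (hv : cl.vars = List.range cl.labels.length)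
    (r : Fin cl.vars.length) : cl.vars.get r = (r : ℕ) := by
  rw [List.get_of_eq hv, List.get_eq_getElem, List.getElem_range]

omit [CharZero K] in
/-- The integer entry, cast to `K`, is the `K`-evaluation of the `K`-point. [folklore] -/
theorem cast_evalInt (c : Cert) (i j : ℕ) :
    ((c.evalInt i j : ℤ) : K) =
      evalC (paddedPermPoint c.n c.m (matCast (R := K) (c.points.getD j [])))
        (c.hwvs.getD i ⟨0, 0, []⟩) := by
  rw [← matCast_map (Int.castRingHom K), matCast_int, paddedPermPoint_map, evalC_map,
    eq_intCast]
  rfl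

/-- **The semantics of a verified canonical certificate** (H1 discharged): tableau polynomials on
the largest matrix variables, points `liftMat g_j * renameMat ρ`. [folklore] -/
theorem semantics (c : Cert) [NeZero c.m] (h : c.verify = true) (hcan : c.canonical = true)
    (hpos : ∀ a ∈ c.lam, 0 < a) (hsum : c.lam.sum = c.m * c.d) :
    Nonempty (c.Semantics K (c.weight hpos hsum)) := by
  classical
  haveI : Infinite K := CharZero.infinite K
  have hst := c.structural_of_verify h
  have hS := c.spec_of_structural hst
  have hS2 := c.spec2_of_structural hst
  have hnm : c.n ≤ c.m := hS.2.1
  have hcan' : ∀ N ∈ c.hwvs, ∀ col ∈ N.cols, col.vars = List.range col.labels.length := by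
    simpa only [canonical, List.all_eq_true, beq_iff_eq] using hcan
  have hmem : ∀ {i : ℕ}, i < c.hwvs.length → c.hwvs.getD i ⟨0, 0, []⟩ ∈ c.hwvs := fun hi => by
    rw [List.getD_eq_getElem _ _ hi]; exact List.getElem_mem _
  have hcanI : ∀ {i : ℕ}, i < c.hwvs.length → ∀ cl ∈ (c.net i).cols,
      cl.vars = List.range cl.labels.length := fun hi cl hcl => hcan' _ (hmem hi) cl hcl
  set E := matIdxEnum c.m with hE
  -- frames, data, polynomials
  let frame : ∀ i, i < c.hwvs.length → NetFrame (c.net i) := fun i hi =>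
    NetFrame.ofCounts _ (c.net_spec hst hi).1 (c.net_spec hst hi).2.1 (c.net_spec hst hi).2.2.1
  let τ : ∀ i, i < c.hwvs.length → TabM (MatIdx c.m) := fun i hi =>
    TabM.ofNetwork E (c.net i) (frame i hi)
  let F : ℕ → MvPolynomial (DegIdx (MatIdx c.m) c.m) K := fun i =>
    if hi : i < c.hwvs.length then (τ i hi).tabPoly K else 0
  let γ : ℕ → Matrix (MatIdx c.m) (MatIdx c.m) K := fun j =>
    liftMat K c.m (matCast (R := K) (c.points.getD j [])) * renameMat K (rho c.n c.m)
  -- the weight at the enumerated variables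
  have hχ : ∀ {i : ℕ} (hi : i < c.hwvs.length), ∀ v, v < c.m * c.m →
      c.weight hpos hsum (E.x v) =
        -((Finset.univ.filter fun col : Fin (c.net i).cols.length =>
            v < ((c.net i).cols.get col).vars.length).card : ℤ) := by
    intro i hi v hv
    rw [weight, hE, dualOfPartition_toMatIdx_x c.m _ v hv,
      sortedParts_eq_of_isChain (c.lamPartition hpos hsum) c.lam rfl hS2.1,
      card_filter_height_eq (c.net i) c.lam (c.net_spec hst hi).2.2.2 (c.net_spec hst hi).1 v]
  refine ⟨⟨F, ?_, γ, ?_⟩⟩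
  · -- highest-weight property
    intro i hrow
    have hi : i < c.hwvs.length := hS.2.2.2.2.2.2.1 i hrow
    show F i ∈ _
    simp only [F, dif_pos hi]
    refine (τ i hi).tabPoly_mem_highestWeightSpace (TabM.frameOfNetwork E _ _)
      (isAntitoneEnum_matIdx c.m) (fun col => ?_) (fun col r => ?_) _ (fun v hv => hχ hi v hv)
    · -- heights ≤ m²
      show ((c.net i).cols.get col).vars.length ≤ c.m * c.m
      rw [(c.net_spec hst hi).1 _ (List.get_mem _ _)]
      exact le_trans (height_le_length _ _ (c.net_spec hst hi).2.2.2 col) hS.2.2.1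
    · -- alternator variables are `x r`
      show E.x (((c.net i).cols.get col).vars.get r) = E.x r
      rw [get_vars_of_canonical _ (hcanI hi _ (List.get_mem _ _))]
  · -- evaluation
    intro i hrow j hcol
    have hi : i < c.hwvs.length := hS.2.2.2.2.2.2.1 i hrow
    -- alternator variables are `< m²`
    have hvars : ∀ cl ∈ (c.net i).cols, ∀ v ∈ cl.vars, v < c.m * c.m := by
      intro cl hcl v hv
      rw [hcanI hi cl hcl, List.mem_range] at hv
      obtain ⟨col, rfl⟩ := List.mem_iff_get.mp hcl
      exact lt_of_lt_of_le hv (le_trans (height_le_length _ _ (c.net_spec hst hi).2.2.2 col) hS.2.2.1)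
    set Pj := paddedPermPoint c.n c.m (matCast (R := K) (c.points.getD j [])) with hPj
    have key : aeval (formCoeff c.m (splfPoly (coefM Pj) (formM E Pj c.m))) ((τ i hi).tabPoly K) =
        evalC Pj (c.net i) := by
      have h1 : aeval (formCoeff c.m (splfPoly (coefM Pj) (formM E Pj c.m))) ((τ i hi).tabPoly K) =
          (τ i hi).EC (coefM Pj) (formM E Pj c.m) :=
        (τ i hi).aeval_formCoeff_tabPoly (K := K) (coefM Pj) (formM E Pj c.m)
      have h2 : (τ i hi).EC (coefM Pj) (formM E Pj c.m) = evalC Pj (c.net i) :=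
        TabM.EC_ofNetwork E Pj (c.net i) (frame i hi) (length_forms_paddedPermPoint hnm _)
          (c.net_spec hst hi).1 hvars (c.net_spec hst hi).2.1 (c.net_spec hst hi).2.2.1
      exact h1.trans h2
    show aeval _ (F i) = _
    simp only [F, dif_pos hi, γ]
    rw [← splfPoly_paddedPermPoint_eq_linSubst K hnm, ← hE, key, c.net_eq hst hi, cast_evalInt]

/-! ## §4 The unconditional theorems -/

/-- **Perm-side lower bound from a verified canonical certificate, unconditionally**:
`c.r ≤ mult_{λ^*} K[Δ(X₀₀^{m-n} per_n)]` over any field of characteristic zero. [folklore] -/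
theorem le_orbitMultiplicity (c : Cert) [NeZero c.m] (h : c.verify = true)
    (hcan : c.canonical = true) :
    c.r ≤ orbitMultiplicity K (paddedPerFormLex K c.n c.m) c.m
      (c.weight (c.lam_pos_of_verify h) (c.lam_sum_of_verify h)) := by
  obtain ⟨S⟩ := c.semantics (K := K) h hcan (c.lam_pos_of_verify h) (c.lam_sum_of_verify h)
  exact c.le_orbitMultiplicity_of_verify S h

/-- **… a symmetric-Kronecker-form obstruction**, given the det-side number
`sk(λ, m×d) ≤ c.sk`. [folklore] -/
theorem perDetSymKroneckerObstructionAt (c : Cert) [NeZero c.m] (h : c.verify = true)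
    (hcan : c.canonical = true)
    (hsk : symKroneckerCoeffRect K c.m c.d
      (c.lamPartition (c.lam_pos_of_verify h) (c.lam_sum_of_verify h)) ≤ c.sk) :
    PerDetSymKroneckerObstructionAt (k := K) c.n c.m c.d
      (c.lamPartition (c.lam_pos_of_verify h) (c.lam_sum_of_verify h)) := by
  obtain ⟨S⟩ := c.semantics (K := K) h hcan (c.lam_pos_of_verify h) (c.lam_sum_of_verify h)
  exact c.perDetSymKroneckerObstructionAt_of_verify h S hsk

/-- **… hence `m < dc(per_n)`** (Ikenmeyer–Panova 2017 Thm. 1.3 / BLMW 2011 Prop. 5.2.1 as proved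
in the tree), from `verify`, `canonical` and the number `sk` alone. [folklore] -/
theorem lt_determinantalComplexity (c : Cert) [NeZero c.m] (h : c.verify = true)
    (hcan : c.canonical = true)
    (hsk : symKroneckerCoeffRect K c.m c.d
      (c.lamPartition (c.lam_pos_of_verify h) (c.lam_sum_of_verify h)) ≤ c.sk) :
    c.m < determinantalComplexity (perPoly (Fin c.n) K) := by
  obtain ⟨S⟩ := c.semantics (K := K) h hcan (c.lam_pos_of_verify h) (c.lam_sum_of_verify h)
  exact c.lt_determinantalComplexity_of_verify h S hsk

end Cert

end TableauEval

end Literature.Computability.AlgebraicComplexity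

end
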